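import Summits.ValiantsHypothesis.ValiantsHypothesis.Theorems.NcSOSDegreeFour
import Mathlib
import HarnessLib

/-!
# Calibrating the sum-of-squares road, I: attained infima, monotonicity, and the floors
# `k ≤ S_F(SOS_k)`, `k ≤ 2·B_F(SOS_k)` in the kernel

Workshop file for the node `CommutativityDial` (decomposition workshop `decomp-valiant`, lens 6
«restricted-models lifting axis», gen 33; census cell D2 / W15 "an `SOS_k` bilinear lower-bound
instrument in the kernel for small `k`"; CALL O-L6-9, part F1a of F1a/F1b). The attackable conjunct
`A_nc = PerNotNcVP` of the dial has ONE road in print, Hrubeš–Wigderson–Yehudayoff's Theorem 1.7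
(`HWY10_thm_1_7`, discharged in `NcSOSPermanent`), whose hypothesis is the NUMERIC conjecture
`HWY10.SOSBilinearSuperlinear F`: `B_F(SOS_k) ≥ c·k^{1+ε}`. This file and its sequel `SOSBilinearHalf`
calibrate that hypothesis with kernel theorems about HWY's two measures of `SOS_k = (Σ x_i²)(Σ y_j²)` —
the bilinear complexity `B_F` (`HWY10.bilinearComplexity`, least `m` with `f = Σ_{l<m} z_l z'_l`) and the
sum-of-squares complexity `S_F` (`sqComplexity` below, least `n` with `f = Σ_{l<n} z_l²`; `S_F(SOS_k)` is
the classical sum-of-squares number `S_F(k)`):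

* §1 representations: `SOS_k = Σ_{(i,j)} (x_i y_j)²` (`sosPoly_eq_sum_sq`), so both infima are attained
  and `B_F(SOS_k) ≤ S_F(SOS_k) ≤ k²` over every commutative ring;
* §2 monotonicity in `k` (`bilinearComplexity_sosPoly_mono`, `sqComplexity_sosPoly_mono`: kill the
  variables `x_i, y_j`, `i, j ≥ k`);
* §3 THE FLOORS over a field with `2 ≠ 0`: substituting `y ↦ e_0` turns a representation into
  `Σ_i x_i² = Σ_l u_l(x)·v_l(x)`; polarising at `e_i, e_j, e_i + e_j` gives the MATRIX identity
  `2·I_k = Σ_l (u_l v_lᵀ + v_l u_lᵀ)` (`polar_identity`), and ranks give `k ≤ 2m` (`k ≤ m` when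
  `v_l = u_l`): **`k ≤ S_F(SOS_k)`** (`le_sqComplexity`, HWY's "trivial bound", §1.2) and
  **`k ≤ 2·B_F(SOS_k)`** (`le_two_mul_bilinearComplexity`), i.e. `B_F(SOS_k) ≥ ⌈k/2⌉`.

The sequel proves the exact transfer `B = ⌈S/2⌉` (HWY Rem 1.5 / J. AMS Rem 1.6 made exact) and the
characteristic-two collapse `¬ HWY10.SOSBilinearSuperlinear F`. Statement-audit datum recorded here: the
context line "`k ≤ B_F(SOS_k) ≤ k²`" in the Literature docstring of `HWY10SumOfSquares` is HWY's floor
for `S_F` (p. 3, "`k ≤ S_F(k) ≤ k²`"); the floor for `B_F` is `⌈k/2⌉` (§3), and it is attained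
(`B(SOS_2) = 1`, `B(SOS_4) = 2`, `B(SOS_8) = 4` over any field with `√-1` and `2 ≠ 0`, by the 2-, 4-,
8-square identities). HONEST FRAMING: linear algebra (HWY §1.2–1.3), kernel-new; a CALIBRATION of the
road's numeric hypothesis — no lower bound on any circuit, nothing here bears on `VP ≠ VNP`.

## References
* [HrubesWigdersonYehudayoff2010] P. Hrubeš, A. Wigderson, A. Yehudayoff, Non-commutative circuits and
  the sum-of-squares problem, STOC 2010, 667–676 (§1.2 (1.1) and the trivial bounds p. 3; §1.3 `B_F`,
  Rem 1.5, Thm 1.7, Thm 1.8); J. Amer. Math. Soc. 24 (2011) 871–898, Remark 1.6.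
-/

noncomputable section

namespace Summit.ValiantsHypothesis.ValiantsHypothesis.Theorems.SOSBilinearCalibration

open MvPolynomial Matrix
open Literature.Computability.AlgebraicComplexity

universe u

/-! ## §1 Representations by products and by squares of bilinear forms -/
section Reps

variable (F : Type u) [CommRing F]

/-- HWY's SUM-OF-SQUARES COMPLEXITY `S_F(f)`: the least `n` such that `f = z_1² + ⋯ + z_n²` with every
`z_l` a bilinear form in `X, Y` (`sInf`; junk value `0` when no such expression exists).
`S_F(SOS_k) = S_F(k)`, the sum-of-squares number. [cite: HrubesWigdersonYehudayoff2010, §1.3] -/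
def sqComplexity {k : ℕ} (f : MvPolynomial (Fin k ⊕ Fin k) F) : ℕ :=
  sInf {n : ℕ | ∃ z : Fin n → Fin k → Fin k → F, f = ∑ l : Fin n, HWY10.bilinForm F (z l) ^ 2}

/-- The indicator table of the pair `q = (i, j)` gives the monomial `x_i y_j` (restated for the
Literature constants; `SOSRoad.bilinForm_single` is the defeq copy). [cite: HrubesWigdersonYehudayoff2010, §1.3] -/
theorem bilinForm_single {k : ℕ} (q : Fin k × Fin k) :
    HWY10.bilinForm F (fun i j => if (i, j) = q then (1 : F) else 0) = X (Sum.inl q.1) * X (Sum.inr q.2) := by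
  unfold HWY10.bilinForm
  rw [← Fintype.sum_prod_type' (f := fun i j =>
    (if (i, j) = q then (1 : F) else 0) • (X (Sum.inl i) * X (Sum.inr j) : MvPolynomial (Fin k ⊕ Fin k) F))]
  simp only [Prod.mk.eta, ite_smul, one_smul, zero_smul, Finset.sum_ite_eq', Finset.mem_univ, if_true]

/-- `SOS_k = Σ_{(i,j)} (x_i y_j)²`: an explicit expression with `k·k` SQUARES of bilinear forms.
[cite: HrubesWigdersonYehudayoff2010, §1.2] -/
theorem sosPoly_eq_sum_sq (k : ℕ) : ∃ z : Fin (k * k) → Fin k → Fin k → F,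
    HWY10.sosPoly F k = ∑ l, HWY10.bilinForm F (z l) ^ 2 := by
  refine ⟨fun l i j => if (i, j) = finProdFinEquiv.symm l then 1 else 0, ?_⟩
  simp only [bilinForm_single]
  show HWY10.sosPoly F k = ∑ l : Fin (k * k), (fun p : Fin k × Fin k =>
    (X (Sum.inl p.1) * X (Sum.inr p.2) : MvPolynomial (Fin k ⊕ Fin k) F) ^ 2) (finProdFinEquiv.symm l)
  rw [Equiv.sum_comp finProdFinEquiv.symm (fun p : Fin k × Fin k =>
    (X (Sum.inl p.1) * X (Sum.inr p.2) : MvPolynomial (Fin k ⊕ Fin k) F) ^ 2), Fintype.sum_prod_type]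
  unfold HWY10.sosPoly
  rw [Finset.sum_mul_sum]
  exact Finset.sum_congr rfl fun i _ => Finset.sum_congr rfl fun j _ => by ring

variable {F}

/-- A sum of squares is a sum of products (`z² = z·z`). [cite: HrubesWigdersonYehudayoff2010, §1.3] -/
theorem rep_of_sqRep {k n : ℕ} {f : MvPolynomial (Fin k ⊕ Fin k) F} (z : Fin n → Fin k → Fin k → F)
    (h : f = ∑ l, HWY10.bilinForm F (z l) ^ 2) :
    f = ∑ l, HWY10.bilinForm F (z l) * HWY10.bilinForm F (z l) := by
  simpa only [sq] using h

/-- A representation with `m` products bounds `B_F(f) ≤ m`. [cite: HrubesWigdersonYehudayoff2010, §1.3] -/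
theorem bilinearComplexity_le_of_rep {k m : ℕ} {f : MvPolynomial (Fin k ⊕ Fin k) F}
    (a b : Fin m → Fin k → Fin k → F)
    (h : f = ∑ l, HWY10.bilinForm F (a l) * HWY10.bilinForm F (b l)) :
    HWY10.bilinearComplexity F f ≤ m := by
  unfold HWY10.bilinearComplexity
  exact Nat.sInf_le ⟨a, b, h⟩

/-- A representation with `n` squares bounds `S_F(f) ≤ n`. [cite: HrubesWigdersonYehudayoff2010, §1.3] -/
theorem sqComplexity_le_of_rep {k n : ℕ} {f : MvPolynomial (Fin k ⊕ Fin k) F}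
    (z : Fin n → Fin k → Fin k → F) (h : f = ∑ l, HWY10.bilinForm F (z l) ^ 2) :
    sqComplexity F f ≤ n := by
  unfold sqComplexity
  exact Nat.sInf_le ⟨z, h⟩

/-- If some product representation exists, one with exactly `B_F(f)` products exists (the infimum is
attained). [cite: HrubesWigdersonYehudayoff2010, §1.3] -/
theorem exists_rep_of_rep {k m : ℕ} {f : MvPolynomial (Fin k ⊕ Fin k) F}
    (a b : Fin m → Fin k → Fin k → F)
    (h : f = ∑ l, HWY10.bilinForm F (a l) * HWY10.bilinForm F (b l)) :
    ∃ a' b' : Fin (HWY10.bilinearComplexity F f) → Fin k → Fin k → F,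
      f = ∑ l, HWY10.bilinForm F (a' l) * HWY10.bilinForm F (b' l) := by
  unfold HWY10.bilinearComplexity
  exact Nat.sInf_mem (⟨m, a, b, h⟩ : {m : ℕ | ∃ a b : Fin m → Fin k → Fin k → F,
    f = ∑ l, HWY10.bilinForm F (a l) * HWY10.bilinForm F (b l)}.Nonempty)

/-- If some square representation exists, one with exactly `S_F(f)` squares exists.
[cite: HrubesWigdersonYehudayoff2010, §1.3] -/
theorem exists_sqRep_of_sqRep {k n : ℕ} {f : MvPolynomial (Fin k ⊕ Fin k) F}
    (z : Fin n → Fin k → Fin k → F) (h : f = ∑ l, HWY10.bilinForm F (z l) ^ 2) :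
    ∃ w : Fin (sqComplexity F f) → Fin k → Fin k → F, f = ∑ l, HWY10.bilinForm F (w l) ^ 2 := by
  unfold sqComplexity
  exact Nat.sInf_mem (⟨n, z, h⟩ : {n : ℕ | ∃ z : Fin n → Fin k → Fin k → F,
    f = ∑ l, HWY10.bilinForm F (z l) ^ 2}.Nonempty)

variable (F)

/-- The trivial sandwich `B_F(SOS_k) ≤ S_F(SOS_k) ≤ k²` over every commutative ring (HWY: "clearly
`B ≤ S`", "`S_F(k) ≤ k²`"). [cite: HrubesWigdersonYehudayoff2010, §1.2–1.3] -/
theorem bilinearComplexity_le_sqComplexity_le_sq (k : ℕ) :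
    HWY10.bilinearComplexity F (HWY10.sosPoly F k) ≤ sqComplexity F (HWY10.sosPoly F k) ∧
      sqComplexity F (HWY10.sosPoly F k) ≤ k ^ 2 := by
  obtain ⟨z, hz⟩ := sosPoly_eq_sum_sq F k
  obtain ⟨w, hw⟩ := exists_sqRep_of_sqRep z hz
  exact ⟨bilinearComplexity_le_of_rep w w (rep_of_sqRep w hw), (sqComplexity_le_of_rep z hz).trans (sq k).ge⟩

end Reps

/-! ## §2 Monotonicity in `k`: killing the variables `x_i, y_j` for `i, j ≥ k` -/
section Restrict

variable (F : Type u) [CommRing F]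

/-- The variable-killing substitution `x_i ↦ x_i`, `y_j ↦ y_j` (`i, j < k`), `x_i, y_j ↦ 0`
(`k ≤ i, j < k + d`). [cite: HrubesWigdersonYehudayoff2010, §1.2] -/
def killTail (k d : ℕ) : Fin (k + d) ⊕ Fin (k + d) → MvPolynomial (Fin k ⊕ Fin k) F :=
  Sum.elim (Fin.append (fun i => X (Sum.inl i)) fun _ => 0) (Fin.append (fun j => X (Sum.inr j)) fun _ => 0)

/-- Killing the tail variables maps a bilinear form to the bilinear form of the top-left block.
[cite: HrubesWigdersonYehudayoff2010, §1.3] -/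
theorem aeval_killTail_bilinForm (k d : ℕ) (e : Fin (k + d) → Fin (k + d) → F) :
    aeval (killTail F k d) (HWY10.bilinForm F e) =
      HWY10.bilinForm F (fun i j => e (Fin.castAdd d i) (Fin.castAdd d j)) := by
  simp only [HWY10.bilinForm, MvPolynomial.smul_eq_C_mul, map_sum, map_add, map_mul, MvPolynomial.aeval_C,
    MvPolynomial.algebraMap_eq, aeval_X, killTail, Sum.elim_inl, Sum.elim_inr, Fin.sum_univ_add,
    Fin.append_left, Fin.append_right, mul_zero, zero_mul, Finset.sum_const_zero, add_zero]

/-- Killing the tail variables maps `SOS_{k+d}` to `SOS_k`. [cite: HrubesWigdersonYehudayoff2010, §1.2] -/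
theorem aeval_killTail_sosPoly (k d : ℕ) :
    aeval (killTail F k d) (HWY10.sosPoly F (k + d)) = HWY10.sosPoly F k := by
  simp only [HWY10.sosPoly, map_mul, map_sum, map_add, map_pow, aeval_X, killTail, Sum.elim_inl,
    Sum.elim_inr, Fin.sum_univ_add, Fin.append_left, Fin.append_right, ne_eq, OfNat.ofNat_ne_zero,
    not_false_eq_true, zero_pow, Finset.sum_const_zero, add_zero]

/-- A product representation of `SOS_{k+d}` restricts to one of `SOS_k` with the same number of
products. [cite: HrubesWigdersonYehudayoff2010, §1.3] -/
theorem restrict_rep {k d m : ℕ} (a b : Fin m → Fin (k + d) → Fin (k + d) → F)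
    (h : HWY10.sosPoly F (k + d) = ∑ l, HWY10.bilinForm F (a l) * HWY10.bilinForm F (b l)) :
    HWY10.sosPoly F k = ∑ l, HWY10.bilinForm F (fun i j => a l (Fin.castAdd d i) (Fin.castAdd d j)) *
      HWY10.bilinForm F (fun i j => b l (Fin.castAdd d i) (Fin.castAdd d j)) := by
  have := congrArg (aeval (killTail F k d)) h
  simpa only [aeval_killTail_sosPoly, map_sum, map_mul, aeval_killTail_bilinForm] using this

/-- A square representation of `SOS_{k+d}` restricts to one of `SOS_k` with the same number of squares.
[cite: HrubesWigdersonYehudayoff2010, §1.3] -/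
theorem restrict_sqRep {k d n : ℕ} (z : Fin n → Fin (k + d) → Fin (k + d) → F)
    (h : HWY10.sosPoly F (k + d) = ∑ l, HWY10.bilinForm F (z l) ^ 2) :
    HWY10.sosPoly F k = ∑ l, HWY10.bilinForm F (fun i j => z l (Fin.castAdd d i) (Fin.castAdd d j)) ^ 2 := by
  have := congrArg (aeval (killTail F k d)) h
  simpa only [aeval_killTail_sosPoly, map_sum, map_pow, aeval_killTail_bilinForm] using this

/-- **Monotonicity.** `B_F(SOS_k) ≤ B_F(SOS_n)` for `k ≤ n`. [cite: HrubesWigdersonYehudayoff2010, §1.3] -/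
theorem bilinearComplexity_sosPoly_mono {k n : ℕ} (hkn : k ≤ n) :
    HWY10.bilinearComplexity F (HWY10.sosPoly F k) ≤ HWY10.bilinearComplexity F (HWY10.sosPoly F n) := by
  obtain ⟨d, rfl⟩ := Nat.exists_eq_add_of_le hkn
  obtain ⟨z, hz⟩ := sosPoly_eq_sum_sq F (k + d)
  obtain ⟨a, b, h⟩ := exists_rep_of_rep z z (rep_of_sqRep z hz)
  exact bilinearComplexity_le_of_rep _ _ (restrict_rep F a b h)

/-- **Monotonicity.** `S_F(SOS_k) ≤ S_F(SOS_n)` for `k ≤ n`. [cite: HrubesWigdersonYehudayoff2010, §1.2] -/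
theorem sqComplexity_sosPoly_mono {k n : ℕ} (hkn : k ≤ n) :
    sqComplexity F (HWY10.sosPoly F k) ≤ sqComplexity F (HWY10.sosPoly F n) := by
  obtain ⟨d, rfl⟩ := Nat.exists_eq_add_of_le hkn
  obtain ⟨z, hz⟩ := sosPoly_eq_sum_sq F (k + d)
  obtain ⟨w, hw⟩ := exists_sqRep_of_sqRep z hz
  exact sqComplexity_le_of_rep _ (restrict_sqRep F w hw)

end Restrict

/-! ## §3 The floors: substitution `y ↦ e_0`, polarisation, rank -/
section Floor

variable {F : Type u} [CommRing F]

/-- Evaluating a bilinear form: `z_e(x, y) = Σ_i x_i·(e_i · y)`. [cite: HrubesWigdersonYehudayoff2010, §1.3] -/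
theorem eval_bilinForm {k : ℕ} (e : Fin k → Fin k → F) (x y : Fin k → F) :
    eval (Sum.elim x y) (HWY10.bilinForm F e) = ∑ i, x i * (e i ⬝ᵥ y) := by
  simp only [HWY10.bilinForm, map_sum, smul_eval, map_mul, eval_X, Sum.elim_inl, Sum.elim_inr,
    dotProduct, Finset.mul_sum]
  exact Finset.sum_congr rfl fun i _ => Finset.sum_congr rfl fun j _ => by ring

/-- Evaluating `SOS_k`: `(x·x)(y·y)`. [cite: HrubesWigdersonYehudayoff2010, §1.2] -/
theorem eval_sosPoly {k : ℕ} (x y : Fin k → F) :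
    eval (Sum.elim x y) (HWY10.sosPoly F k) = (x ⬝ᵥ x) * (y ⬝ᵥ y) := by
  simp only [HWY10.sosPoly, map_mul, map_sum, eval_X, Sum.elim_inl, Sum.elim_inr, dotProduct, sq]

/-- **Substitution `y ↦ e_{j₀}`.** A product representation of `SOS_k` gives, for every `x`,
`x·x = Σ_l (x·u_l)(x·v_l)` with `u_l = a_l(·, j₀)`, `v_l = b_l(·, j₀)`. [cite: HrubesWigdersonYehudayoff2010, §1.3] -/
theorem dot_of_rep {k m : ℕ} (j₀ : Fin k) (a b : Fin m → Fin k → Fin k → F)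
    (h : HWY10.sosPoly F k = ∑ l, HWY10.bilinForm F (a l) * HWY10.bilinForm F (b l)) (x : Fin k → F) :
    x ⬝ᵥ x = ∑ l, (x ⬝ᵥ fun i => a l i j₀) * (x ⬝ᵥ fun i => b l i j₀) := by
  have hx := congrArg (eval (Sum.elim x (Pi.single j₀ (1 : F)))) h
  simp only [eval_sosPoly, map_sum, map_mul, eval_bilinForm, dotProduct_single, Pi.single_eq_same,
    mul_one] at hx
  simpa only [dotProduct] using hx

/-- **Polarisation.** If `x·x = Σ_l (x·u_l)(x·v_l)` for all `x ∈ F^k`, then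
`2·I_k = Σ_l (u_l v_lᵀ + v_l u_lᵀ)` (evaluate at `e_i`, `e_j`, `e_i + e_j`). [cite: HrubesWigdersonYehudayoff2010, §1.2] -/
theorem polar_identity {k m : ℕ} (u v : Fin m → Fin k → F)
    (h : ∀ x : Fin k → F, x ⬝ᵥ x = ∑ l, (x ⬝ᵥ u l) * (x ⬝ᵥ v l)) :
    (2 : F) • (1 : Matrix (Fin k) (Fin k) F) = ∑ l, (vecMulVec (u l) (v l) + vecMulVec (v l) (u l)) := by
  ext i j
  simp only [Matrix.smul_apply, Matrix.sum_apply, Matrix.add_apply, vecMulVec_apply, smul_eq_mul]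
  by_cases e : i = j
  · subst e
    have hi := h (Pi.single i 1)
    simp only [single_dotProduct, Pi.single_eq_same, one_mul] at hi
    have hs : ∑ l, (u l i * v l i + v l i * u l i) = 2 * ∑ l, u l i * v l i := by
      rw [Finset.mul_sum]
      exact Finset.sum_congr rfl fun l _ => by ring
    rw [Matrix.one_apply_eq, mul_one, hs, ← hi, mul_one]
  · have hi := h (Pi.single i 1)
    have hj := h (Pi.single j 1)
    have hij := h (Pi.single i 1 + Pi.single j 1)
    simp only [add_dotProduct, single_dotProduct, Pi.add_apply, Pi.single_eq_same,
      Pi.single_eq_of_ne e, Pi.single_eq_of_ne (Ne.symm e), one_mul, add_zero, zero_add] at hi hj hij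
    have expand : ∑ l, (u l i + u l j) * (v l i + v l j) =
        ∑ l, u l i * v l i + ∑ l, (u l i * v l j + v l i * u l j) + ∑ l, u l j * v l j := by
      rw [← Finset.sum_add_distrib, ← Finset.sum_add_distrib]
      exact Finset.sum_congr rfl fun l _ => by ring
    rw [Matrix.one_apply_ne e, mul_zero]
    linear_combination hij - hi - hj + expand

/-- Rank is subadditive (via `range (A + B) ≤ range A ⊔ range B`). [cite: HrubesWigdersonYehudayoff2010, §1.2] -/
theorem rank_add_le {K : Type*} [Field K] {m n : Type*} [Fintype m] [Fintype n] (A B : Matrix m n K) :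
    (A + B).rank ≤ A.rank + B.rank := by
  unfold Matrix.rank
  rw [Matrix.mulVecLin_add]
  exact (Submodule.finrank_mono (LinearMap.range_add_le _ _)).trans
    (Submodule.finrank_add_le_finrank_add_finrank _ _)

/-- `rank (2·I_k) = k` when `2 ≠ 0`. [cite: HrubesWigdersonYehudayoff2010, §1.2] -/
theorem rank_two_smul_one {K : Type*} [Field K] (h2 : (2 : K) ≠ 0) (k : ℕ) :
    ((2 : K) • (1 : Matrix (Fin k) (Fin k) K)).rank = k := by
  have hu : IsUnit ((2 : K) • (1 : Matrix (Fin k) (Fin k) K)) := by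
    rw [Matrix.isUnit_iff_isUnit_det, Matrix.det_smul, Matrix.det_one, mul_one, Fintype.card_fin]
    exact (pow_ne_zero k h2).isUnit
  rw [Matrix.rank_of_isUnit _ hu, Fintype.card_fin]

/-- **Rank count, products.** `x·x = Σ_{l<m} (x·u_l)(x·v_l)` on `F^k` forces `k ≤ 2m` (`2 ≠ 0`).
[cite: HrubesWigdersonYehudayoff2010, §1.3] -/
theorem le_two_mul_of_dot_rep {K : Type u} [Field K] {k m : ℕ} (h2 : (2 : K) ≠ 0)
    (u v : Fin m → Fin k → K) (h : ∀ x : Fin k → K, x ⬝ᵥ x = ∑ l, (x ⬝ᵥ u l) * (x ⬝ᵥ v l)) :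
    k ≤ 2 * m := by
  have hs : (∑ l : Fin m, (vecMulVec (u l) (v l) + vecMulVec (v l) (u l))).rank ≤ 2 * m := by
    refine (Finset.le_sum_of_subadditive (fun A : Matrix (Fin k) (Fin k) K => A.rank)
      (Matrix.rank_zero).le (fun A B => rank_add_le A B) Finset.univ
      (fun l => vecMulVec (u l) (v l) + vecMulVec (v l) (u l))).trans ?_
    refine (Finset.sum_le_sum fun l _ => (rank_add_le _ _).trans
      (add_le_add (Matrix.rank_vecMulVec_le (u l) (v l)) (Matrix.rank_vecMulVec_le (v l) (u l)))).trans ?_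
    rw [Finset.sum_const, Finset.card_univ, Fintype.card_fin, smul_eq_mul]
    omega
  calc k = ((2 : K) • (1 : Matrix (Fin k) (Fin k) K)).rank := (rank_two_smul_one h2 k).symm
    _ ≤ 2 * m := by rw [polar_identity u v h]; exact hs

/-- **Rank count, squares.** `x·x = Σ_{l<n} (x·u_l)²` on `F^k` forces `k ≤ n` (`2 ≠ 0`).
[cite: HrubesWigdersonYehudayoff2010, §1.2] -/
theorem le_of_dot_sqRep {K : Type u} [Field K] {k n : ℕ} (h2 : (2 : K) ≠ 0)
    (u : Fin n → Fin k → K) (h : ∀ x : Fin k → K, x ⬝ᵥ x = ∑ l, (x ⬝ᵥ u l) * (x ⬝ᵥ u l)) :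
    k ≤ n := by
  have hs : (∑ l : Fin n, (vecMulVec (u l) (u l) + vecMulVec (u l) (u l))).rank ≤ n := by
    refine (Finset.le_sum_of_subadditive (fun A : Matrix (Fin k) (Fin k) K => A.rank)
      (Matrix.rank_zero).le (fun A B => rank_add_le A B) Finset.univ
      (fun l => vecMulVec (u l) (u l) + vecMulVec (u l) (u l))).trans ?_
    have h1 : ∀ l : Fin n, (vecMulVec (u l) (u l) + vecMulVec (u l) (u l)).rank ≤ 1 := fun l => by
      rw [← two_smul K, Matrix.smul_eq_diagonal_mul]
      exact (Matrix.rank_mul_le_right _ _).trans (Matrix.rank_vecMulVec_le _ _)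
    refine (Finset.sum_le_sum fun l _ => h1 l).trans ?_
    simp
  calc k = ((2 : K) • (1 : Matrix (Fin k) (Fin k) K)).rank := (rank_two_smul_one h2 k).symm
    _ ≤ n := by rw [polar_identity u u h]; exact hs

/-- **THE FLOOR FOR `B`.** `k ≤ 2·B_F(SOS_k)` over every field with `2 ≠ 0`, i.e. `B_F(SOS_k) ≥ ⌈k/2⌉`.
[cite: HrubesWigdersonYehudayoff2010, §1.3] -/
theorem le_two_mul_bilinearComplexity {K : Type u} [Field K] (h2 : (2 : K) ≠ 0) (k : ℕ) :
    k ≤ 2 * HWY10.bilinearComplexity K (HWY10.sosPoly K k) := by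
  rcases Nat.eq_zero_or_pos k with rfl | hk
  · exact Nat.zero_le _
  obtain ⟨z, hz⟩ := sosPoly_eq_sum_sq K k
  obtain ⟨a, b, h⟩ := exists_rep_of_rep z z (rep_of_sqRep z hz)
  exact le_two_mul_of_dot_rep h2 _ _ (dot_of_rep ⟨0, hk⟩ a b h)

/-- **THE FLOOR FOR `S`** (HWY's "trivial bound" `k ≤ S_F(k)`, §1.2): `k ≤ S_F(SOS_k)` over every field
with `2 ≠ 0`. [cite: HrubesWigdersonYehudayoff2010, §1.2] -/
theorem le_sqComplexity {K : Type u} [Field K] (h2 : (2 : K) ≠ 0) (k : ℕ) :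
    k ≤ sqComplexity K (HWY10.sosPoly K k) := by
  rcases Nat.eq_zero_or_pos k with rfl | hk
  · exact Nat.zero_le _
  obtain ⟨z, hz⟩ := sosPoly_eq_sum_sq K k
  obtain ⟨w, hw⟩ := exists_sqRep_of_sqRep z hz
  exact le_of_dot_sqRep h2 _ (dot_of_rep ⟨0, hk⟩ w w (rep_of_sqRep w hw))

end Floor

end Summit.ValiantsHypothesis.ValiantsHypothesis.Theorems.SOSBilinearCalibration

end
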